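import Literature.NumberTheory.LFunctions.WeilExplicit
import Literature.NumberTheory.LFunctions.WeilMellinBounds
import Literature.NumberTheory.LFunctions.WeilMellinInversion
import Literature.NumberTheory.LFunctions.WeilMellinPolyDecay
import Literature.NumberTheory.LFunctions.WeilExplicitRightEdge
import Literature.NumberTheory.LFunctions.WeilExplicitArchTermProofs
import Literature.NumberTheory.LFunctions.EulerMaclaurinZeta
import Mathlib.Analysis.Calculus.Deriv.Support
import Mathlib.Analysis.SpecialFunctions.ImproperIntegrals
import Mathlib.MeasureTheory.Integral.Prod

/-!
# Stub `stub_remainderPairing` for crux `SignCone.SignConeOscillatory` (stmt-RiemannHypothesis-16302), line Sketch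

The remainder term `-s ∫_N^∞ B̄₁(x) x^{-(s+1)} dx` of the order-zero Euler–Maclaurin formula for
`ζ` (`Literature.NumberTheory.LFunctions.riemannZeta_eq_eulerMaclaurin₀`) paired with the Weil
transform `F̂(s) = weilMellin F s = ∫ F(t) e^{(s - 1/2)t} dt` on the critical line `s = 1/2 + iy`:
for a Weil test function `F` with `tsupport F ⊆ (-∞, log N]`, `N ≥ 1`,
`∫ F̂(1/2 + iy) · s · (∫_N^∞ B̄₁(x) x^{-(s+1)} dx) dy = 0`.

Proof: `s F̂(s) = Ĥ(s)` with `H = F/2 - F'` (integration by parts, `weilMellin_deriv`), a Weil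
test function vanishing on `(log N, ∞)`; Fubini on `ℝ_y × (N, ∞)` (the integrand is dominated by
`‖Ĥ(1/2 + iy)‖ · x^{-3/2}/2`); the inner integral is Mellin inversion
`∫ Ĥ(1/2 + iy) x^{-(3/2 + iy)} dy = 2π H(log x) x^{-3/2}` (`weilMellin_inversion'`), and
`H(log x) = 0` for `x > N`.
-/

noncomputable section
set_option linter.dupNamespace false
open scoped BigOperators ComplexConjugate Real
open Complex MeasureTheory Set Filter

namespace Summit.RiemannHypothesis.RiemannHypothesis.Theorems.SignConeOscillatory

open Literature.NumberTheory.LFunctions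

/-- `H = F/2 - F'` is a Weil test function whenever `F` is. -/
theorem isWeilTest_half_sub_deriv {F : ℝ → ℂ} (hF : IsWeilTest F) :
    IsWeilTest ((fun t => (1 / 2 : ℂ) * F t) + fun t => (-1 : ℂ) * deriv F t) :=
  (hF.const_mul _).add (hF.deriv.const_mul _)

/-- `Ĥ(s) = s F̂(s)` for `H = F/2 - F'` (integration by parts: `(F')^(s) = -(s - 1/2) F̂(s)`). -/
theorem weilMellin_half_sub_deriv {F : ℝ → ℂ} (hF : IsWeilTest F) (s : ℂ) :
    weilMellin ((fun t => (1 / 2 : ℂ) * F t) + fun t => (-1 : ℂ) * deriv F t) s =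
      s * weilMellin F s := by
  have h1 := hF.const_mul (1 / 2 : ℂ)
  have h2 := hF.deriv.const_mul (-1 : ℂ)
  rw [weilMellin_add h1.1.continuous h1.2 h2.1.continuous h2.2, weilMellin_const_mul,
    weilMellin_const_mul, weilMellin_deriv hF]
  ring

/-- `H = F/2 - F'` vanishes off the topological support of `F`. -/
theorem half_sub_deriv_eq_zero {F : ℝ → ℂ} {t : ℝ} (ht : t ∉ tsupport F) :
    ((fun t => (1 / 2 : ℂ) * F t) + fun t => (-1 : ℂ) * deriv F t) t = 0 := by
  simp only [Pi.add_apply, image_eq_zero_of_notMem_tsupport ht, deriv_of_notMem_tsupport ht]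
  simp

/-- **Remainder pairing for a test function vanishing on `(log N, ∞)`.** For a Weil test
function `H` with `H = 0` on `(log N, ∞)`, `N ≥ 1`, the function
`y ↦ Ĥ(1/2 + iy) ∫_N^∞ B̄₁(x) x^{-(3/2 + iy)} dx` is integrable with integral zero
(Fubini, Mellin inversion `∫ Ĥ(1/2 + iy) x^{-iy} dy = 2π H(log x)`, and `H(log x) = 0` for `x > N`). -/
theorem integral_weilMellin_vertical_mul_bernoulliIntegral_eq_zero {H : ℝ → ℂ}
    (hH : IsWeilTest H) {N : ℕ} (hN : 1 ≤ N) (hH0 : ∀ t : ℝ, Real.log N < t → H t = 0) :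
    Integrable (fun y : ℝ => weilMellin H (1 / 2 + y * I) *
        bernoulliIntegral 1 N (1 / 2 + y * I)) ∧
      ∫ y : ℝ, weilMellin H (1 / 2 + y * I) * bernoulliIntegral 1 N (1 / 2 + y * I) = 0 := by
  have hN0 : (0 : ℝ) < N := by exact_mod_cast hN
  have hHc : Continuous H := hH.1.continuous
  have hcont : Continuous (weilMellin H) := continuous_weilMellin hHc hH.2
  have hhalf : ((1 / 2 : ℝ) : ℂ) = 1 / 2 := by push_cast; ring
  -- the integrand of the double integral
  set Φ : ℝ → ℝ → ℂ := fun y x => weilMellin H (1 / 2 + y * I) *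
    ((bernoulliPer 1 x : ℂ) * (x : ℂ) ^ (-((1 / 2 : ℂ) + y * I + 1))) with hΦ
  have hfun : (fun y : ℝ => weilMellin H (1 / 2 + y * I) *
      bernoulliIntegral 1 N (1 / 2 + y * I)) = fun y : ℝ => ∫ x in Ioi (N : ℝ), Φ y x := by
    funext y
    simp only [hΦ, bernoulliIntegral, Nat.cast_one, ← integral_const_mul]
  -- Step 1: integrability on `ℝ × (N, ∞)`.
  have hint : Integrable (Function.uncurry Φ)
      ((volume : Measure ℝ).prod (volume.restrict (Ioi (N : ℝ)))) := by
    have h1 : Integrable (fun y : ℝ => weilMellin H (1 / 2 + y * I)) := by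
      have := integrable_weilMellin_vertical hH (1 / 2)
      simp only [hhalf] at this
      exact this
    have h2 : Integrable (fun x : ℝ => (1 / 2 : ℝ) * x ^ (-(3 / 2 : ℝ)))
        (volume.restrict (Ioi (N : ℝ))) :=
      (integrableOn_Ioi_rpow_of_lt (by norm_num) hN0).const_mul _
    have hmeas : AEStronglyMeasurable (Function.uncurry Φ)
        ((volume : Measure ℝ).prod (volume.restrict (Ioi (N : ℝ)))) := by
      have hb : Measurable (bernoulliPer 1) := measurable_bernoulliPer 1
      refine Measurable.aestronglyMeasurable ?_
      simp only [hΦ, Function.uncurry_def]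
      fun_prop
    have hae : ∀ᵐ p : ℝ × ℝ ∂((volume : Measure ℝ).prod (volume.restrict (Ioi (N : ℝ)))),
        p.2 ∈ Ioi (N : ℝ) :=
      (Measure.quasiMeasurePreserving_snd).ae (ae_restrict_mem measurableSet_Ioi)
    refine Integrable.mono' (h1.norm.mul_prod h2) hmeas (hae.mono fun p hp => ?_)
    obtain ⟨y, x⟩ := p
    have hx0 : 0 < x := hN0.trans hp
    simp only [Function.uncurry_apply_pair, hΦ, norm_mul, Complex.norm_real, Real.norm_eq_abs,
      Complex.norm_cpow_eq_rpow_re_of_pos hx0]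
    have hre : (-((1 / 2 : ℂ) + y * I + 1)).re = -(3 / 2 : ℝ) := by simp; norm_num
    rw [hre]
    have hx' : 0 ≤ x ^ (-(3 / 2 : ℝ)) := Real.rpow_nonneg hx0.le _
    exact mul_le_mul_of_nonneg_left (mul_le_mul_of_nonneg_right (abs_bernoulliPer_one_le x) hx')
      (norm_nonneg _)
  refine ⟨?_, ?_⟩
  · rw [hfun]
    exact hint.integral_prod_left
  · rw [hfun, integral_integral_swap hint]
    refine setIntegral_eq_zero_of_forall_eq_zero fun x hx => ?_
    have hx0 : 0 < x := hN0.trans hx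
    have hxC : (x : ℂ) ≠ 0 := ofReal_ne_zero.2 hx0.ne'
    have hlog : Complex.log (x : ℂ) = ((Real.log x : ℝ) : ℂ) := (Complex.ofReal_log hx0.le).symm
    have hHx : H (Real.log x) = 0 := hH0 _ (Real.log_lt_log hN0 hx)
    have key := weilMellin_inversion' hH (1 / 2) (Real.log x)
    simp only [hhalf] at key
    have e : ∀ y : ℝ, Φ y x = weilMellin H (1 / 2 + y * I) *
        cexp (-((1 / 2 - 1 / 2 : ℂ) + y * I) * (Real.log x : ℝ)) *
        ((bernoulliPer 1 x : ℂ) * cexp (-(3 / 2 : ℂ) * (Real.log x : ℝ))) := by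
      intro y
      simp only [hΦ]
      rw [Complex.cpow_def_of_ne_zero hxC, hlog]
      have hexp : cexp (((Real.log x : ℝ) : ℂ) * -((1 / 2 : ℂ) + y * I + 1)) =
          cexp (-((1 / 2 - 1 / 2 : ℂ) + y * I) * (Real.log x : ℝ)) *
            cexp (-(3 / 2 : ℂ) * (Real.log x : ℝ)) := by
        rw [← Complex.exp_add]
        congr 1
        ring
      rw [hexp]
      ring
    calc ∫ y : ℝ, Φ y x = ∫ y : ℝ, weilMellin H (1 / 2 + y * I) *
          cexp (-((1 / 2 - 1 / 2 : ℂ) + y * I) * (Real.log x : ℝ)) *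
          ((bernoulliPer 1 x : ℂ) * cexp (-(3 / 2 : ℂ) * (Real.log x : ℝ))) := by
            congr 1 with y
            exact e y
      _ = 2 * π * H (Real.log x) *
          ((bernoulliPer 1 x : ℂ) * cexp (-(3 / 2 : ℂ) * (Real.log x : ℝ))) := by
            rw [integral_mul_const, key]
      _ = 0 := by rw [hHx]; ring

/-- STUB `stub_remainderPairing` (card A, the remainder term of Euler–Maclaurin of order zero on the
critical line). For a Weil test `F` supported in `(-∞, log N]`, `N ≥ 1`, the remainder term
`s ∫_N^∞ B̄₁(x) x^{-(s+1)} dx` of `ζ(s)` pairs with `F̂` on `Re s = 1/2` to zero: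
`∫ F̂(1/2 + iy) (1/2 + iy) (∫_N^∞ B̄₁(x) x^{-(3/2 + iy)} dx) dy = 0`, the integrand being
integrable (`s F̂(s) = Ĥ(s)` with `H = F/2 - F'`, then
`integral_weilMellin_vertical_mul_bernoulliIntegral_eq_zero`). -/
theorem stub_remainderPairing :
    ∀ (F : ℝ → ℂ) (N : ℕ), 1 ≤ N → IsWeilTest F → tsupport F ⊆ Set.Iic (Real.log N) →
      Integrable (fun y : ℝ => weilMellin F (1 / 2 + y * I) *
          ((1 / 2 + y * I) * bernoulliIntegral 1 N (1 / 2 + y * I))) ∧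
      ∫ y : ℝ, weilMellin F (1 / 2 + y * I) *
          ((1 / 2 + y * I) * bernoulliIntegral 1 N (1 / 2 + y * I)) = 0 := by
  intro F N hN hF hsupp
  have hHt : IsWeilTest ((fun t => (1 / 2 : ℂ) * F t) + fun t => (-1 : ℂ) * deriv F t) :=
    isWeilTest_half_sub_deriv hF
  have hH0 : ∀ t : ℝ, Real.log N < t →
      ((fun t => (1 / 2 : ℂ) * F t) + fun t => (-1 : ℂ) * deriv F t) t = 0 :=
    fun t ht => half_sub_deriv_eq_zero fun h => not_le.2 ht (hsupp h)
  have e : ∀ y : ℝ, weilMellin F (1 / 2 + y * I) *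
      ((1 / 2 + y * I) * bernoulliIntegral 1 N (1 / 2 + y * I)) =
      weilMellin ((fun t => (1 / 2 : ℂ) * F t) + fun t => (-1 : ℂ) * deriv F t) (1 / 2 + y * I) *
        bernoulliIntegral 1 N (1 / 2 + y * I) := fun y => by
    rw [weilMellin_half_sub_deriv hF]
    ring
  simp_rw [e]
  exact integral_weilMellin_vertical_mul_bernoulliIntegral_eq_zero hHt hN hH0

end Summit.RiemannHypothesis.RiemannHypothesis.Theorems.SignConeOscillatory

end
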